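import Summits.ResolutionOfSingularities.KangarooAtlas.MizutaniPBasisTower
import Summits.ResolutionOfSingularities.KangarooAtlas.MizutaniLemma24Tower
import Literature.AlgebraicGeometry.Resolution.SharpOrderCoordinateCentre
import HarnessLib

/-!
# Mizutani's Lemma 2.4 (dual pair form) over the complement field — any field `k`

Cell `pub-rosobs`, Mizutani enclosure (seat mizutani-encloser-2, gen 9).  AI-written; *AI review is weaker than expert review*;
NOT a resolution-of-singularities theorem (summit relevance C).

Step (4), first half, of the route to Lemma 2.4 / 2.7 over fields of INFINITE `p`-degree (seat HANDOFF § PLAN).  Encloser-1's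
`lemma24_pair_of_isRootTower` needs `k` to be a root tower over ITS OWN `k^{p^{e+1}}` and `k^{p^e}` (finite `p`-degree).  With the
complement towers of `MizutaniPBasisTower` (`k` is a root tower over `G_j = k^{p^j}(Λ ∖ b) ⊇ k^{p^j}` for every `j ≥ 1`, any `k`) the same
digit-split / Lucas argument runs for EVERY `k`, with two changes: the hypothesis is instantiated with the RESTRICTION OF SCALARS of the
tower operator `D^{(M)}` (a `k^{p^{e+1}}`-linear differential operator of `k`, Literature `IsDiffOpLE.restrictScalars`), and the low
`Ω_e`-coefficient is read through Oda's duality `forall_sum_apply_mul_eq_zero_iff` and the flip `tens_mem_pow_comm` instead of tower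
coordinates.  The conclusion is membership of `Σ a_i ⊗ c_i` in `J^{p^{e+1}}` of `k ⊗_{G_{e+1}} k` (base the complement field); the lift to
`k ⊗_{k^{p^{e+1}}} k` (injectivity of `k ⊗_{k^{pq}} k^{pq}(b) → k ⊗_{G} k` when `c_i ∈ k^{pq}(b)`) is the remaining second half.

* `coe_adjoin_frobPow_succ_subset` (`G_{e+1} ⊆ G_e`), `hsD_eq_of_complement_towers` (the operators of the two complement towers agree on
  the small box);
* `lemma24_pair_zero` — the level pair `(0, 1)` for ANY `k` by duality alone;
* **`lemma24_pair_complement`** — for towers `h₁ : IsRootTower G_{e+1} k p^{e+1} x₁ b`, `h₀ : IsRootTower G_e k p^e x₀ b` over the complement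
  fields of one `p`-basis: the pair hypothesis (over `k^{p^e}`, `k^{p^{e+1}}`) gives `Σ a_i ⊗_{G_{e+1}} c_i ∈ J_{k/G_{e+1}}^{p^{e+1}}`;
  **`lemma24_pair_complement_of_pBasis`** — the same from a `p`-basis `Λ ⊇ range b` (`isRootTower_complement`), any `k`, `e ≥ 1`.

References: [Mizutani1973HironakaGroupSchemes] Lemma 2.4 (p. 88–89); EGA IV₄ 16.8.8, 16.11.2 [EGAIV4].
-/

noncomputable section

open MvPolynomial TensorProduct Literature.AlgebraicGeometry.Resolution
  Literature.AlgebraicGeometry.Resolution.HironakaScheme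

namespace Summit.ResolutionOfSingularities.KangarooAtlas.Mizutani

universe u

section Complement

variable (k : Type u) [Field k] (p : ℕ) [hp : Fact p.Prime] [CharP k p] {n s : ℕ}

/-- `k^{p^{e+1}}(Λ') ⊆ k^{p^e}(Λ')` as subsets of `k`. [folklore] -/
theorem coe_adjoin_frobPow_succ_subset (Λ' : Set k) (e : ℕ) :
    ((IntermediateField.adjoin (frobPow k p (e + 1)) Λ' : IntermediateField (frobPow k p (e + 1)) k) : Set k) ⊆
      (IntermediateField.adjoin (frobPow k p e) Λ' : Set k) := by
  intro z hz
  have hz' : z ∈ (IntermediateField.adjoin (frobPow k p (e + 1)) Λ').toSubfield := hz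
  rw [IntermediateField.adjoin_toSubfield] at hz'
  show z ∈ (IntermediateField.adjoin (frobPow k p e) Λ').toSubfield
  rw [IntermediateField.adjoin_toSubfield]
  refine Subfield.closure_mono (Set.union_subset_union_left _ ?_) hz'
  rintro _ ⟨c, rfl⟩
  exact ⟨⟨(c : k), frobPow_anti (Nat.le_succ e) c.2⟩, rfl⟩

/-- **The operators of the two complement towers agree on the small box**: for root tower structures of `k` over `G_{e+1} = k^{p^{e+1}}(Λ')`
(order `p^{e+1}`) and over `G_e = k^{p^e}(Λ')` (order `p^e`) with the same generators `b`, `D₁^{(T)} = D₀^{(T)}` for `T` in the box of side `p^e`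
(both are `G_{e+1}`-linear and map `b^N ↦ C(N,T) b^{N−T}`). [cite: EGAIV4, Thm. 16.11.2 (16.11.2.1)] -/
theorem hsD_eq_of_complement_towers {Λ' : Set k} {e : ℕ} {b : Fin s → k}
    {x₁ : Fin s → IntermediateField.adjoin (frobPow k p (e + 1)) Λ'} {x₀ : Fin s → IntermediateField.adjoin (frobPow k p e) Λ'}
    (h₁ : IsRootTower (IntermediateField.adjoin (frobPow k p (e + 1)) Λ') k (p ^ (e + 1)) x₁ b)
    (h₀ : IsRootTower (IntermediateField.adjoin (frobPow k p e) Λ') k (p ^ e) x₀ b)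
    {T : Fin s →₀ ℕ} (hT : InBox (p ^ e) T) (y : k) : h₁.hsD T y = h₀.hsD T y := by
  have hT₁ : InBox (p ^ (e + 1)) T := fun i =>
    lt_of_lt_of_le (hT i) (Nat.pow_le_pow_right hp.out.pos (Nat.le_succ e))
  let Ψ : k →ₗ[IntermediateField.adjoin (frobPow k p (e + 1)) Λ'] k :=
    { toFun := h₀.hsD T
      map_add' := fun y z => map_add _ y z
      map_smul' := fun c z => by
        have hc : (c : k) ∈ IntermediateField.adjoin (frobPow k p e) Λ' := coe_adjoin_frobPow_succ_subset k p Λ' e c.2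
        have := (h₀.hsD T).map_smul (⟨(c : k), hc⟩ : IntermediateField.adjoin (frobPow k p e) Λ') z
        rw [IntermediateField.smul_def, IntermediateField.smul_def] at this
        rw [RingHom.id_apply, IntermediateField.smul_def, IntermediateField.smul_def]
        exact this }
  have hΨ : ∀ z, Ψ z = h₀.hsD T z := fun _ => rfl
  rw [← hΨ]
  refine congrArg (fun Φ : k →ₗ[IntermediateField.adjoin (frobPow k p (e + 1)) Λ'] k => Φ y)
    (h₁.linearMap_ext_boxMonomials (Ψ := Ψ) fun N _ => ?_)
  rw [hΨ, h₁.hsD_prod_pow hT₁ N, h₀.hsD_prod_pow hT N]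

/-- **Lemma 2.4, dual pair form, for the level pair `(0, 1)` — any field** (`Diff_0(k/k) = k`, so the hypothesis is Oda's duality for
`Σ c_i ⊗ a_i` directly). [cite: Mizutani1973HironakaGroupSchemes, Lemma 2.4 (q' = 1)] -/
theorem lemma24_pair_zero (a c : Fin (n + 1) → k)
    (hac : ∀ (D' : k →ₗ[frobPow k p 0] k) (D₀ : k →ₗ[frobPow k p (0 + 1)] k), IsDiffOpLE (frobPow k p 0) (p ^ 0 - 1) D' →
      IsDiffOpLE (frobPow k p (0 + 1)) (p ^ (0 + 1) - p ^ 0) D₀ → ∑ i, D' (a i) * D₀ (c i) = 0) :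
    tens k p (0 + 1) a c ∈ KaehlerDifferential.ideal (frobPow k p (0 + 1)) k ^ p ^ (0 + 1) := by
  rw [tens_mem_pow_comm]
  refine (forall_sum_apply_mul_eq_zero_iff k p (0 + 1) c a).mp fun D₀ hD₀ => ?_
  have h := hac LinearMap.id D₀ (by rw [pow_zero, Nat.sub_self]; exact isDiffOpLE_id (R := ↥(frobPow k p 0))) (by simpa using hD₀)
  simpa [mul_comm] using h

/-- **MIZUTANI'S LEMMA 2.4 (dual pair form) OVER THE COMPLEMENT FIELD, ANY `k`.**  Let `h₁`, `h₀` be root tower structures of `k` over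
`G_{e+1} = k^{p^{e+1}}(Λ')` (order `p^{e+1}`) and `G_e = k^{p^e}(Λ')` (order `p^e`) with the same generators `b` (`MizutaniPBasisTower`).  If
`Σ_i D'(a_i)·D₀(c_i) = 0` for all `D' ∈ Diff_{p^e−1}(k/k^{p^e})` and `D₀ ∈ Diff_{p^{e+1}−p^e}(k/k^{p^{e+1}})`, then
`Σ a_i ⊗ c_i ∈ J^{p^{e+1}}` in `k ⊗_{G_{e+1}} k`.  Proof = encloser-1's digit split / Lucas argument with `D₀ := D^{(M)}|_{k^{p^{e+1}}}` and the low
coefficient read by duality. AI-written; *AI review is weaker than expert review*. [cite: Mizutani1973HironakaGroupSchemes, Lemma 2.4] -/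
theorem lemma24_pair_complement {Λ' : Set k} {e : ℕ} {b : Fin s → k}
    {x₁ : Fin s → IntermediateField.adjoin (frobPow k p (e + 1)) Λ'} {x₀ : Fin s → IntermediateField.adjoin (frobPow k p e) Λ'}
    (h₁ : IsRootTower (IntermediateField.adjoin (frobPow k p (e + 1)) Λ') k (p ^ (e + 1)) x₁ b)
    (h₀ : IsRootTower (IntermediateField.adjoin (frobPow k p e) Λ') k (p ^ e) x₀ b) (a c : Fin (n + 1) → k)
    (hac : ∀ (D' : k →ₗ[frobPow k p e] k) (D₀ : k →ₗ[frobPow k p (e + 1)] k), IsDiffOpLE (frobPow k p e) (p ^ e - 1) D' →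
      IsDiffOpLE (frobPow k p (e + 1)) (p ^ (e + 1) - p ^ e) D₀ → ∑ i, D' (a i) * D₀ (c i) = 0) :
    (∑ i, a i ⊗ₜ[IntermediateField.adjoin (frobPow k p (e + 1)) Λ'] c i) ∈
      KaehlerDifferential.ideal (IntermediateField.adjoin (frobPow k p (e + 1)) Λ') k ^ p ^ (e + 1) := by
  classical
  have hp2 : 2 ≤ p := hp.out.two_le
  have hqpos : 0 < p ^ e := pow_pos hp.out.pos e
  refine h₁.mem_pow_of_forall_coeff_Omega fun N hN => ?_
  by_contra hlt
  push Not at hlt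
  have hNbox : InBox (p ^ (e + 1)) N := h₁.Omega_box _ N hN
  have hNsum : ∑ i, N i + 1 ≤ p * p ^ e := by
    rw [← Finsupp.degree_eq_sum, ← pow_succ']; exact hlt
  obtain ⟨T, hdig, hTN, hTlt, hTsum, hMsum⟩ := DigitLemma.exists_digit_split' hp2 e (fun i => N i) hNsum
  set T' : Fin s →₀ ℕ := Finsupp.equivFunOnFinite.symm T with hT'
  have hT'i : ∀ i, T' i = T i := fun i => by rw [hT', Finsupp.coe_equivFunOnFinite_symm]
  have hT'le : T' ≤ N := fun i => by rw [hT'i]; exact hTN i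
  set M' : Fin s →₀ ℕ := N - T' with hM'
  have hTM : M' + T' = N := tsub_add_cancel_of_le hT'le
  have hT'box : InBox (p ^ e) T' := fun i => by rw [hT'i]; exact hTlt i
  have hT'deg : T'.degree ≤ p ^ e - 1 := by
    rw [Finsupp.degree_eq_sum]
    have : ∑ i, T' i = ∑ i, T i := Finset.sum_congr rfl fun i _ => hT'i i
    omega
  have hM'box : InBox (p ^ (e + 1)) M' := fun i => by
    rw [hM', Finsupp.tsub_apply]; exact lt_of_le_of_lt (Nat.sub_le _ _) (hNbox i)
  have hM'deg : M'.degree ≤ p ^ (e + 1) - p ^ e := by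
    rw [Finsupp.degree_eq_sum]
    have : ∑ i, M' i = ∑ i, (N i - T i) := Finset.sum_congr rfl fun i _ => by rw [hM', Finsupp.tsub_apply, hT'i]
    rw [this, pow_succ']
    omega
  -- instantiate the hypothesis with `D₀ = D^{(M')}` restricted to `k^{p^{e+1}}`-scalars
  set d : Fin (n + 1) → k := fun i => h₁.hsD M' (c i) with hd
  have hD₀ : IsDiffOpLE (frobPow k p (e + 1)) (p ^ (e + 1) - p ^ e)
      ((h₁.hsD M').restrictScalars (frobPow k p (e + 1))) := (h₁.isDiffOpLE_hsD _ hM'box hM'deg).restrictScalars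
  have htens : tens k p e a d ∈ KaehlerDifferential.ideal (frobPow k p e) k ^ p ^ e :=
    (forall_sum_apply_mul_eq_zero_iff k p e a d).mp fun D' hD' => hac D' _ hD' hD₀
  -- the low coefficient by duality: `Σ a_i · D₀^{(T')}(d_i) = 0` (`|T'| ≤ p^e − 1`)
  have hcoef : ∑ i, a i * h₀.hsD T' (d i) = 0 := by
    have hflip := (tens_mem_pow_comm k p e a d (p ^ e)).mp htens
    have h0T : IsDiffOpLE (frobPow k p e) (p ^ e - 1) ((h₀.hsD T').restrictScalars (frobPow k p e)) :=
      (h₀.isDiffOpLE_hsD _ hT'box hT'deg).restrictScalars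
    have := (forall_sum_apply_mul_eq_zero_iff k p e d a).mpr hflip _ h0T
    rw [← this]
    exact Finset.sum_congr rfl fun i _ => by rw [LinearMap.restrictScalars_apply, mul_comm]
  -- `D₀^{(T')} D₁^{(M')} = D₁^{(T')} D₁^{(M')} = C(N,T') D₁^{(N)}`
  have hcomp : ∀ i, h₀.hsD T' (d i) = (mchoose N T' : k) * h₁.hsD N (c i) := by
    intro i
    rw [hd, ← hsD_eq_of_complement_towers k p h₁ h₀ hT'box, h₁.hsD_comm, h₁.hsD_hsD, hTM]
  simp_rw [hcomp] at hcoef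
  have hsum : (mchoose N T' : k) * ∑ i, a i * h₁.hsD N (c i) = 0 := by
    rw [Finset.mul_sum, ← hcoef]
    exact Finset.sum_congr rfl fun i _ => by ring
  have hC : (mchoose N T' : k) ≠ 0 := mchoose_cast_ne_zero_of_digitLE k p fun i => by rw [hT'i]; exact hdig i
  have hzero : ∑ i, a i * h₁.hsD N (c i) = 0 := (mul_eq_zero.mp hsum).resolve_left hC
  rw [← h₁.coeff_Omega_sum_tmul Finset.univ a c N] at hzero
  exact (mem_support_iff.mp hN) hzero

end Complement

end Summit.ResolutionOfSingularities.KangarooAtlas.Mizutani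

end
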